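import Summits.QuantumFields.YangMills.Theorems.SmallCircleAnchorAnchorGapDefectRatio

/-!
# Holonomy defects are dilute at strong pinning (crux `AnchorGap`, static gauge)

Helper for crux stmt-QuantumFields-11141 (`AnchorGap`, route `SmallCircleAnchor`), line
independent — the Peierls-type large-field input for the holonomy field in `stub_abelianisation`.
In the static gauge (`kill`: time-like links outside the top layer set to `1`; the Polyakov line
above `x` is then the single top-layer link `p_x = U ((-1, x), none)`, a priori an independent Haar
variable), for every measurable defect region `D ⊆ G` and finite set `K` of spatial sites the
un-normalised weight of "every `p_x`, `x ∈ K`, lies in `D`" is at most `(e^{12 N |β|} ρ_s(D))^{|K|}`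
times the partition function, `ρ_s(D) = ∫_D e^{-sV} dHaar / ∫_G e^{-sV} dHaar`
(`holonomy_defects_dilute`, registered sub-goal; with `exists_pinningStrength`, p147343, `ρ_s(U₀ᶜ)`
is as small as desired for `s ≥ s₀`: defects form a dilute Bernoulli-dominated field, uniformly in
`L`). Proof: each `p_x` enters exactly `6` electric plaquettes (`|Re tr| ≤ N`) and its own pinning
factor; `defect_ratio_bound` (p154499) with the block `S = {top links over K}` and
`∫ ∏_{x∈K} 1_D(p_x) e^{-sV(p_x)} = (∫_D e^{-sV})^{|K|}`.
-/

set_option autoImplicit false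

noncomputable section

namespace Summit.QuantumFields.YangMills.Theorems.AnchorGap

open MeasureTheory
open Literature.MathematicalPhysics.QuantumFieldTheory

namespace Defects

/-- **Holonomy defects are dilute at strong pinning** (crux `AnchorGap` vocabulary, static gauge;
registered sub-goal). For every measurable `D ⊆ G` and finite set `K` of spatial sites,
`∫ (∏_{x ∈ K} 1_D(U((-1,x),none))) · wgt (kill U) dν ≤ (e^{12N|β|} ρ_s(D))^{|K|} ∫ wgt (kill U) dν`
with `ρ_s(D) = ∫_D e^{-sV} dHaar / ∫ e^{-sV} dHaar`. [folklore] -/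
theorem holonomy_defects_dilute :
    ∀ (G : Type) [Group G] [TopologicalSpace G] [IsTopologicalGroup G] [CompactSpace G], letI : MeasurableSpace G := borel G; haveI : BorelSpace G := ⟨rfl⟩; ∀ (r : LatticeRep G) (V : G → ℝ), Continuous V → ∀ (T : ℕ) [NeZero T] (β s : ℝ) (L : ℕ) [NeZero L], let St := ZMod T × (Fin 3 → ZMod L); let Cfg := St × Option (Fin 3) → G; let ν : MeasureTheory.Measure Cfg := MeasureTheory.Measure.pi fun _ => haarProbability G; let sh : St → Option (Fin 3) → St := fun x μ => Option.elim μ (x.1 + 1, x.2) fun i => (x.1, x.2 + Pi.single i 1); let pl : Cfg → St → Option (Fin 3) → Option (Fin 3) → G := fun U x μ κ => U (x, μ) * U (sh x μ, κ) * (U (sh x κ, μ))⁻¹ * (U (x, κ))⁻¹; let act : Cfg → ℝ := fun U => β * ∑ x : St, ∑ i : Fin 3, (r.ρ (pl U x none (some i))).trace.re + β * ∑ x : St, ∑ q : {q : Fin 3 × Fin 3 // q.1 < q.2}, (r.ρ (pl U x (some q.1.1) (some q.1.2))).trace.re; let P : Cfg → (Fin 3 → ZMod L) → G := fun U x => (List.ofFn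 fun t : Fin T => U ((((t : ℕ) : ZMod T), x), none)).prod; let wgt : Cfg → ℝ := fun U => Real.exp (act U - s * ∑ x : Fin 3 → ZMod L, V (P U x)); let kill : Cfg → Cfg := fun U p => if p.2 = none ∧ p.1.1 + 1 ≠ 0 then 1 else U p; ∀ (D : Set G), MeasurableSet D → ∀ (K : Finset (Fin 3 → ZMod L)), ∫ U, (∏ x ∈ K, D.indicator (fun _ => (1 : ℝ)) (U (((-1 : ZMod T), x), none))) * wgt (kill U) ∂ν ≤ (Real.exp (12 * r.N * |β|) * ((∫ g in D, Real.exp (-(s * V g)) ∂haarProbability G) / (∫ g, Real.exp (-(s * V g)) ∂haarProbability G))) ^ K.card * ∫ U, wgt (kill U) ∂ν := by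
  intro G _ _ _ _
  letI : MeasurableSpace G := borel G
  haveI : BorelSpace G := ⟨rfl⟩
  intro r V hVc T _ β s L _ St Cfg ν sh pl act P wgt kill D hD K
  classical
  haveI : SecondCountableTopology G :=
    (r.continuous.isClosedEmbedding r.injective).isEmbedding.secondCountableTopology
  haveI : IsProbabilityMeasure (haarProbability G) := inferInstance
  let top : (Fin 3 → ZMod L) → St × Option (Fin 3) := fun x => (((-1 : ZMod T), x), none)
  have htop_inj : Function.Injective top := by
    intro x y h
    have := congrArg (fun q : St × Option (Fin 3) => q.1.2) h
    simpa [top] using this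
  let f₀ : G → ℝ := fun g => Real.exp (-(s * V g))
  let f₁ : G → ℝ := fun g => D.indicator (fun _ => (1 : ℝ)) g * Real.exp (-(s * V g))
  have hf₀pos : ∀ g, 0 < f₀ g := fun g => Real.exp_pos _
  have hf₁nn : ∀ g, 0 ≤ f₁ g := fun g =>
    mul_nonneg (Set.indicator_nonneg (fun _ _ => zero_le_one) g) (Real.exp_pos _).le
  have hf₁le : ∀ g, f₁ g ≤ f₀ g := fun g =>
    mul_le_of_le_one_left (Real.exp_pos _).le (Set.indicator_le_self' (fun _ _ => zero_le_one) g)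
  have hkill_top : ∀ (U : Cfg) (x : Fin 3 → ZMod L), kill U (top x) = U (top x) := by
    intro U x
    show (if (none : Option (Fin 3)) = none ∧ (-1 : ZMod T) + 1 ≠ 0 then (1 : G) else U (top x)) = U (top x)
    rw [if_neg (fun h => h.2 (by ring))]
  have hkill_low : ∀ (U : Cfg) (t : ZMod T) (x : Fin 3 → ZMod L), t + 1 ≠ 0 →
      kill U ((t, x), none) = 1 := by
    intro U t x ht
    show (if (none : Option (Fin 3)) = none ∧ t + 1 ≠ 0 then (1 : G) else U ((t, x), none)) = 1
    rw [if_pos ⟨rfl, ht⟩]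
  have hPk : ∀ (U : Cfg) (x : Fin 3 → ZMod L), P (kill U) x = U (top x) := by
    intro U x
    obtain ⟨T', hT'⟩ : ∃ T', T = T' + 1 := ⟨T - 1, (Nat.sub_add_cancel NeZero.one_le).symm⟩
    subst hT'
    show (List.ofFn fun t : Fin (T' + 1) => kill U ((((t : ℕ) : ZMod (T' + 1)), x), none)).prod =
      U (top x)
    rw [List.ofFn_succ', List.concat_eq_append, List.prod_append, List.prod_singleton]
    have hlast : (((Fin.last T' : Fin (T' + 1)) : ℕ) : ZMod (T' + 1)) = -1 := by
      refine eq_neg_of_add_eq_zero_left ?_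
      rw [Fin.val_last]
      have : (((T' : ℕ) : ZMod (T' + 1)) + 1) = ((T' + 1 : ℕ) : ZMod (T' + 1)) := by push_cast; ring
      rw [this, ZMod.natCast_self]
    have hinit : (List.ofFn fun i : Fin T' =>
        kill U ((((i.castSucc : ℕ) : ZMod (T' + 1)), x), none)).prod = 1 := by
      apply List.prod_eq_one
      intro g hg
      rw [List.mem_ofFn] at hg
      obtain ⟨i, rfl⟩ := hg
      refine hkill_low U _ x ?_
      rw [Fin.val_castSucc]
      have h1 : (((i : ℕ) : ZMod (T' + 1)) + 1) = ((i + 1 : ℕ) : ZMod (T' + 1)) := by push_cast; ring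
      rw [h1, Ne, ZMod.natCast_eq_zero_iff]
      intro hd
      have := Nat.eq_zero_of_dvd_of_lt hd (by omega)
      omega
    rw [hinit, one_mul, hlast, hkill_top]
  let J : Finset (St × Fin 3) := Finset.univ.filter fun yi =>
    yi.1.1 = -1 ∧ (yi.1.2 ∈ K ∨ yi.1.2 + Pi.single yi.2 1 ∈ K)
  have hJcard : J.card ≤ 6 * K.card := by
    have hsub : J ⊆ Finset.univ.biUnion fun i : Fin 3 =>
        (K.image fun x => (((-1 : ZMod T), x), i)) ∪
          (K.image fun x => (((-1 : ZMod T), x - Pi.single i 1), i)) := by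
      intro yi hyi
      simp only [J, Finset.mem_filter, Finset.mem_univ, true_and] at hyi
      obtain ⟨h1, h2⟩ := hyi
      simp only [Finset.mem_biUnion, Finset.mem_univ, true_and, Finset.mem_union, Finset.mem_image]
      refine ⟨yi.2, ?_⟩
      rcases h2 with h2 | h2
      · left; exact ⟨yi.1.2, h2, by rw [← h1]⟩
      · right; exact ⟨_, h2, by rw [← h1, add_sub_cancel_right]⟩
    calc J.card ≤ (Finset.univ.biUnion fun i : Fin 3 =>
          (K.image fun x => (((-1 : ZMod T), x), i)) ∪
            (K.image fun x => (((-1 : ZMod T), x - Pi.single i 1), i))).card :=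
          Finset.card_le_card hsub
      _ ≤ ∑ i : Fin 3, ((K.image fun x => (((-1 : ZMod T), x), i)) ∪
            (K.image fun x => (((-1 : ZMod T), x - Pi.single i 1), i))).card :=
          Finset.card_biUnion_le
      _ ≤ ∑ _i : Fin 3, (K.card + K.card) := by
          refine Finset.sum_le_sum fun i _ => (Finset.card_union_le _ _).trans (add_le_add ?_ ?_) <;>
            exact Finset.card_image_le
      _ = 6 * K.card := by simp; ring
  let e : Cfg → St × Fin 3 → ℝ := fun U yi => (r.ρ (pl (kill U) yi.1 none (some yi.2))).trace.re
  let mag : Cfg → ℝ := fun U => β * ∑ x : St, ∑ q : {q : Fin 3 × Fin 3 // q.1 < q.2},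
    (r.ρ (pl (kill U) x (some q.1.1) (some q.1.2))).trace.re
  let AK : Cfg → ℝ := fun U => β * ∑ yi ∈ J, e U yi
  let AR : Cfg → ℝ := fun U => β * ∑ yi ∈ Jᶜ, e U yi + mag U
  have hact : ∀ U : Cfg, act (kill U) = AK U + AR U := by
    intro U
    show β * ∑ x : St, ∑ i : Fin 3, (r.ρ (pl (kill U) x none (some i))).trace.re + mag U =
      β * ∑ yi ∈ J, e U yi + (β * ∑ yi ∈ Jᶜ, e U yi + mag U)
    have hsum : ∑ x : St, ∑ i : Fin 3, (r.ρ (pl (kill U) x none (some i))).trace.re =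
        ∑ yi ∈ J, e U yi + ∑ yi ∈ Jᶜ, e U yi := by
      rw [← Finset.sum_product' (f := fun x i => (r.ρ (pl (kill U) x none (some i))).trace.re),
        Finset.univ_product_univ, ← Finset.sum_add_sum_compl J]
    rw [hsum]; ring
  have hAK : ∀ U : Cfg, |AK U| ≤ 6 * K.card * r.N * |β| := by
    intro U
    show |β * ∑ yi ∈ J, e U yi| ≤ _
    rw [abs_mul]
    have h1 : |∑ yi ∈ J, e U yi| ≤ ∑ _yi ∈ J, (r.N : ℝ) :=
      (Finset.abs_sum_le_sum_abs _ _).trans (Finset.sum_le_sum fun yi _ => abs_trace_re_le G r _)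
    rw [Finset.sum_const, nsmul_eq_mul] at h1
    have h2 : (J.card : ℝ) * r.N ≤ 6 * K.card * r.N := by
      have : (J.card : ℝ) ≤ 6 * K.card := by exact_mod_cast hJcard
      exact mul_le_mul_of_nonneg_right this (Nat.cast_nonneg _)
    calc |β| * |∑ yi ∈ J, e U yi| ≤ |β| * (6 * K.card * r.N) :=
          mul_le_mul_of_nonneg_left (h1.trans h2) (abs_nonneg β)
      _ = 6 * K.card * r.N * |β| := by ring
  let F₂ : Cfg → ℝ := fun U => Real.exp (AR U - s * ∑ x ∈ Kᶜ, V (U (top x)))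
  let F₀ : Cfg → ℝ := fun U => ∏ x ∈ K, f₀ (U (top x))
  let F₁ : Cfg → ℝ := fun U => ∏ x ∈ K, f₁ (U (top x))
  have hwk : ∀ U : Cfg, wgt (kill U) = Real.exp (AK U) * (F₀ U * F₂ U) := by
    intro U
    show Real.exp (act (kill U) - s * ∑ x : Fin 3 → ZMod L, V (P (kill U) x)) = _
    have hP : ∑ x : Fin 3 → ZMod L, V (P (kill U) x) =
        ∑ x ∈ K, V (U (top x)) + ∑ x ∈ Kᶜ, V (U (top x)) := by
      rw [← Finset.sum_add_sum_compl K]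
      simp only [hPk]
    have hF₀ : F₀ U = Real.exp (-(s * ∑ x ∈ K, V (U (top x)))) := by
      show ∏ x ∈ K, Real.exp (-(s * V (U (top x)))) = _
      rw [← Real.exp_sum, Finset.mul_sum, ← Finset.sum_neg_distrib]
    rw [hact, hP, hF₀]
    show _ = Real.exp (AK U) * (Real.exp (-(s * ∑ x ∈ K, V (U (top x)))) *
      Real.exp (AR U - s * ∑ x ∈ Kᶜ, V (U (top x))))
    rw [← Real.exp_add, ← Real.exp_add]
    congr 1; ring
  have hnumk : ∀ U : Cfg, (∏ x ∈ K, D.indicator (fun _ => (1 : ℝ)) (U (top x))) * wgt (kill U) =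
      Real.exp (AK U) * (F₁ U * F₂ U) := by
    intro U
    rw [hwk U]
    have : (∏ x ∈ K, D.indicator (fun _ => (1 : ℝ)) (U (top x))) * F₀ U = F₁ U := by
      show (∏ x ∈ K, D.indicator (fun _ => (1 : ℝ)) (U (top x))) *
        (∏ x ∈ K, Real.exp (-(s * V (U (top x))))) = ∏ x ∈ K, (D.indicator (fun _ => (1 : ℝ)) (U (top x)) * Real.exp (-(s * V (U (top x)))))
      rw [← Finset.prod_mul_distrib]
    rw [← this]; ring
  let Sset : Set (St × Option (Fin 3)) := {q | ∃ x ∈ K, top x = q}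
  have htop_mem : ∀ x, top x ∈ Sset ↔ x ∈ K := by
    intro x
    constructor
    · rintro ⟨y, hy, hxy⟩; rwa [← htop_inj hxy]
    · intro hx; exact ⟨x, hx, rfl⟩
  have hSnone : ∀ q ∈ Sset, q.2 = none ∧ q.1.1 = -1 := by
    rintro q ⟨x, -, rfl⟩; exact ⟨rfl, rfl⟩
  have hdep₁ : DependsOn F₁ Sset := by
    intro U U' h
    show ∏ x ∈ K, f₁ (U (top x)) = ∏ x ∈ K, f₁ (U' (top x))
    exact Finset.prod_congr rfl fun x hx => by rw [h _ ((htop_mem x).2 hx)]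
  have hdep₀ : DependsOn F₀ Sset := by
    intro U U' h
    show ∏ x ∈ K, f₀ (U (top x)) = ∏ x ∈ K, f₀ (U' (top x))
    exact Finset.prod_congr rfl fun x hx => by rw [h _ ((htop_mem x).2 hx)]
  -- `kill U q` only sees coordinates outside `Sset`, except at the top links over `K`
  have hkq : ∀ U U' : Cfg, (∀ q, q ∈ Ssetᶜ → U q = U' q) → ∀ q : St × Option (Fin 3),
      (q ∉ Sset ∨ (q.2 = none ∧ q.1.1 + 1 ≠ 0)) → kill U q = kill U' q := by
    intro U U' h q hq
    rcases hq with hq | ⟨hq1, hq2⟩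
    · show (if q.2 = none ∧ q.1.1 + 1 ≠ 0 then (1 : G) else U q) =
        (if q.2 = none ∧ q.1.1 + 1 ≠ 0 then (1 : G) else U' q)
      rw [h q hq]
    · show (if q.2 = none ∧ q.1.1 + 1 ≠ 0 then (1 : G) else U q) =
        (if q.2 = none ∧ q.1.1 + 1 ≠ 0 then (1 : G) else U' q)
      rw [if_pos ⟨hq1, hq2⟩, if_pos ⟨hq1, hq2⟩]
  have hsome : ∀ (y : St) (i : Fin 3), (y, some i) ∉ Sset := by
    intro y i hmem; exact Option.some_ne_none i (hSnone _ hmem).1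
  have htime : ∀ (t : ZMod T) (z : Fin 3 → ZMod L), z ∉ K →
      (((t, z), none) ∉ Sset ∨ ((((t, z), none) : St × Option (Fin 3)).2 = none ∧
        (((t, z), none) : St × Option (Fin 3)).1.1 + 1 ≠ 0)) := by
    intro t z hz
    by_cases ht : t + 1 = 0
    · left
      have ht' : t = -1 := eq_neg_of_add_eq_zero_left ht
      subst ht'
      intro hmem
      exact hz ((htop_mem z).1 hmem)
    · right; exact ⟨rfl, ht⟩
  have hdep₂ : DependsOn F₂ Ssetᶜ := by
    intro U U' h
    have hk := hkq U U' h
    have hmag : mag U = mag U' := by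
      show β * ∑ x : St, ∑ q : {q : Fin 3 × Fin 3 // q.1 < q.2},
          (r.ρ (pl (kill U) x (some q.1.1) (some q.1.2))).trace.re =
        β * ∑ x : St, ∑ q : {q : Fin 3 × Fin 3 // q.1 < q.2},
          (r.ρ (pl (kill U') x (some q.1.1) (some q.1.2))).trace.re
      congr 1
      refine Finset.sum_congr rfl fun x _ => Finset.sum_congr rfl fun q _ => ?_
      show (r.ρ (kill U (x, some q.1.1) * kill U (sh x (some q.1.1), some q.1.2) *
          (kill U (sh x (some q.1.2), some q.1.1))⁻¹ * (kill U (x, some q.1.2))⁻¹)).trace.re =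
        (r.ρ (kill U' (x, some q.1.1) * kill U' (sh x (some q.1.1), some q.1.2) *
          (kill U' (sh x (some q.1.2), some q.1.1))⁻¹ * (kill U' (x, some q.1.2))⁻¹)).trace.re
      rw [hk _ (Or.inl (hsome _ _)), hk _ (Or.inl (hsome _ _)), hk _ (Or.inl (hsome _ _)),
        hk _ (Or.inl (hsome _ _))]
    have he : ∀ yi ∈ Jᶜ, e U yi = e U' yi := by
      intro yi hyi
      rw [Finset.mem_compl] at hyi
      have hyi' : ¬ (yi.1.1 = -1 ∧ (yi.1.2 ∈ K ∨ yi.1.2 + Pi.single yi.2 1 ∈ K)) := by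
        simpa [J] using hyi
      obtain ⟨⟨t, z⟩, i⟩ := yi
      simp only at hyi'
      -- the two time-like links of the plaquette
      have hz1 : t + 1 ≠ 0 ∨ z ∉ K := by
        by_cases ht : t + 1 = 0
        · right; intro hz; exact hyi' ⟨eq_neg_of_add_eq_zero_left ht, Or.inl hz⟩
        · left; exact ht
      have hz2 : t + 1 ≠ 0 ∨ z + Pi.single i 1 ∉ K := by
        by_cases ht : t + 1 = 0
        · right; intro hz; exact hyi' ⟨eq_neg_of_add_eq_zero_left ht, Or.inr hz⟩
        · left; exact ht
      have hl1 : kill U ((t, z), none) = kill U' ((t, z), none) := by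
        rcases hz1 with h1 | h1
        · exact hk _ (Or.inr ⟨rfl, h1⟩)
        · exact hk _ (htime t z h1)
      have hl2 : kill U ((t, z + Pi.single i 1), none) = kill U' ((t, z + Pi.single i 1), none) := by
        rcases hz2 with h1 | h1
        · exact hk _ (Or.inr ⟨rfl, h1⟩)
        · exact hk _ (htime t _ h1)
      show (r.ρ (kill U ((t, z), none) * kill U (sh (t, z) none, some i) *
          (kill U (sh (t, z) (some i), none))⁻¹ * (kill U ((t, z), some i))⁻¹)).trace.re =
        (r.ρ (kill U' ((t, z), none) * kill U' (sh (t, z) none, some i) *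
          (kill U' (sh (t, z) (some i), none))⁻¹ * (kill U' ((t, z), some i))⁻¹)).trace.re
      have hsh1 : sh (t, z) none = (t + 1, z) := rfl
      have hsh2 : sh (t, z) (some i) = (t, z + Pi.single i 1) := rfl
      rw [hsh1, hsh2, hl1, hl2, hk _ (Or.inl (hsome _ _)), hk _ (Or.inl (hsome _ _))]
    have hAR : AR U = AR U' := by
      show β * ∑ yi ∈ Jᶜ, e U yi + mag U = β * ∑ yi ∈ Jᶜ, e U' yi + mag U'
      rw [hmag, Finset.sum_congr rfl he]
    have hV : ∑ x ∈ Kᶜ, V (U (top x)) = ∑ x ∈ Kᶜ, V (U' (top x)) := by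
      refine Finset.sum_congr rfl fun x hx => ?_
      rw [Finset.mem_compl] at hx
      rw [h (top x) (fun hmem => hx ((htop_mem x).1 hmem))]
    show Real.exp (AR U - s * ∑ x ∈ Kᶜ, V (U (top x))) =
      Real.exp (AR U' - s * ∑ x ∈ Kᶜ, V (U' (top x)))
    rw [hAR, hV]
  have hkc : Continuous kill := by
    refine continuous_pi fun q => ?_
    by_cases hq : q.2 = none ∧ q.1.1 + 1 ≠ 0
    · simp only [kill, if_pos hq]; exact continuous_const
    · simp only [kill, if_neg hq]; exact continuous_apply q
  have hplc : ∀ (x : St) (μ κ : Option (Fin 3)), Continuous fun U : Cfg => pl (kill U) x μ κ := by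
    intro x μ κ
    show Continuous fun U : Cfg => kill U (x, μ) * kill U (sh x μ, κ) * (kill U (sh x κ, μ))⁻¹ *
      (kill U (x, κ))⁻¹
    have hc : ∀ q, Continuous fun U : Cfg => kill U q := fun q => (continuous_apply q).comp hkc
    exact (((hc _).mul (hc _)).mul (hc _).inv).mul (hc _).inv
  have htrc : ∀ (x : St) (μ κ : Option (Fin 3)),
      Continuous fun U : Cfg => (r.ρ (pl (kill U) x μ κ)).trace.re := fun x μ κ =>
    Complex.continuous_re.comp ((r.continuous.comp (hplc x μ κ)).matrix_trace)
  have hAKc : Continuous AK :=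
    continuous_const.mul (continuous_finsetSum _ fun yi _ => htrc yi.1 none (some yi.2))
  have hARc : Continuous AR :=
    (continuous_const.mul (continuous_finsetSum _ fun yi _ => htrc yi.1 none (some yi.2))).add
      (continuous_const.mul (continuous_finsetSum _ fun x _ =>
        continuous_finsetSum _ fun q _ => htrc x (some q.1.1) (some q.1.2)))
  have hF₂c : Continuous F₂ :=
    Real.continuous_exp.comp (hARc.sub (continuous_const.mul
      (continuous_finsetSum _ fun x _ => hVc.comp (continuous_apply _))))
  have hF₀c : Continuous F₀ :=
    continuous_finsetProd _ fun x _ =>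
      Real.continuous_exp.comp ((continuous_const.mul (hVc.comp (continuous_apply _))).neg)
  have hf₁m : Measurable f₁ :=
    ((measurable_const.indicator hD).mul (Real.continuous_exp.comp
      ((continuous_const.mul hVc).neg)).measurable)
  have hF₁m : Measurable F₁ :=
    Finset.measurable_prod _ fun x _ => hf₁m.comp (measurable_pi_apply _)
  have hF₂m : Measurable F₂ := hF₂c.measurable
  have hF₀m : Measurable F₀ := hF₀c.measurable
  set k : ℕ := K.card with hk_def
  set B : ℝ := 6 * k * r.N * |β| with hB
  have hF₂pos : ∀ U, 0 < F₂ U := fun U => Real.exp_pos _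
  have hF₀pos : ∀ U, 0 < F₀ U := fun U => Finset.prod_pos fun x _ => hf₀pos _
  have hF₁nn : ∀ U, 0 ≤ F₁ U := fun U => Finset.prod_nonneg fun x _ => hf₁nn _
  have hF₁le : ∀ U, F₁ U ≤ F₀ U := fun U =>
    Finset.prod_le_prod (fun x _ => hf₁nn _) fun x _ => hf₁le _
  obtain ⟨M₂, hM₂⟩ : ∃ M, ∀ U : Cfg, F₂ U ≤ M := by
    obtain ⟨M, hM⟩ := isCompact_univ.exists_bound_of_continuousOn hF₂c.continuousOn
    exact ⟨M, fun U => (le_abs_self _).trans (by simpa [Real.norm_eq_abs] using hM U (Set.mem_univ U))⟩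
  obtain ⟨M₀, hM₀⟩ : ∃ M, ∀ U : Cfg, F₀ U ≤ M := by
    obtain ⟨M, hM⟩ := isCompact_univ.exists_bound_of_continuousOn hF₀c.continuousOn
    exact ⟨M, fun U => (le_abs_self _).trans (by simpa [Real.norm_eq_abs] using hM U (Set.mem_univ U))⟩
  have hprod : ∀ (f : G → ℝ), (∫ U, ∏ x ∈ K, f (U (top x)) ∂ν) =
      (∫ g, f g ∂haarProbability G) ^ k := by
    intro f
    let gq : (St × Option (Fin 3)) → G → ℝ := fun q g => if q ∈ K.image top then f g else 1
    have h1 : ∀ U : Cfg, ∏ x ∈ K, f (U (top x)) = ∏ q, gq q (U q) := by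
      intro U
      show _ = ∏ q, (if q ∈ K.image top then f (U q) else 1)
      rw [Finset.prod_ite_mem, Finset.univ_inter, Finset.prod_image fun x _ y _ h => htop_inj h]
    simp_rw [h1]
    have h2 := integral_fintype_prod_eq_prod (𝕜 := ℝ) (fun q => gq q)
      (μ := fun _ : St × Option (Fin 3) => haarProbability G)
    rw [show (Measure.pi fun _ : St × Option (Fin 3) => haarProbability G) = ν from rfl] at h2
    rw [h2]
    have h3 : ∀ q, ∫ g, gq q g ∂haarProbability G =
        if q ∈ K.image top then ∫ g, f g ∂haarProbability G else 1 := by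
      intro q
      by_cases hq : q ∈ K.image top
      · simp only [gq, if_pos hq]
      · simp only [gq, if_neg hq]
        simp
    simp_rw [h3]
    rw [Finset.prod_ite_mem, Finset.univ_inter, Finset.prod_const,
      Finset.card_image_of_injective _ htop_inj]
  have hIF₁ : ∫ U, F₁ U ∂ν = (∫ g, f₁ g ∂haarProbability G) ^ k := hprod f₁
  have hIF₀ : ∫ U, F₀ U ∂ν = (∫ g, f₀ g ∂haarProbability G) ^ k := hprod f₀
  have hf₁int : ∫ g, f₁ g ∂haarProbability G = ∫ g in D, Real.exp (-(s * V g)) ∂haarProbability G := by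
    rw [← integral_indicator hD]
    refine integral_congr_ae (ae_of_all _ fun g => ?_)
    show D.indicator (fun _ => (1 : ℝ)) g * Real.exp (-(s * V g)) =
      D.indicator (fun g => Real.exp (-(s * V g))) g
    by_cases hg : g ∈ D
    · simp [Set.indicator_of_mem hg]
    · simp [Set.indicator_of_notMem hg]
  -- positivity of the a-priori integrals
  have hf₀int_pos : 0 < ∫ g, f₀ g ∂haarProbability G := by
    obtain ⟨M, hM⟩ : ∃ M : ℝ, ∀ g : G, |V g| ≤ M := by
      obtain ⟨M, hM⟩ := isCompact_univ.exists_bound_of_continuousOn hVc.continuousOn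
      exact ⟨M, fun g => by simpa [Real.norm_eq_abs] using hM g (Set.mem_univ g)⟩
    have hlow : ∀ g, Real.exp (-(|s| * M)) ≤ f₀ g := by
      intro g
      show Real.exp (-(|s| * M)) ≤ Real.exp (-(s * V g))
      refine Real.exp_le_exp.2 (neg_le_neg ?_)
      calc s * V g ≤ |s * V g| := le_abs_self _
        _ = |s| * |V g| := abs_mul _ _
        _ ≤ |s| * M := mul_le_mul_of_nonneg_left (hM g) (abs_nonneg s)
    have hf₀c : Continuous f₀ := Real.continuous_exp.comp ((continuous_const.mul hVc).neg)
    have hf₀i : Integrable f₀ (haarProbability G) :=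
      integrable_of_abs_le _ hf₀c.measurable (c := Real.exp (|s| * M)) fun g => by
        rw [abs_of_pos (hf₀pos g)]
        show Real.exp (-(s * V g)) ≤ Real.exp (|s| * M)
        refine Real.exp_le_exp.2 ?_
        calc -(s * V g) ≤ |s * V g| := neg_le_abs _
          _ = |s| * |V g| := abs_mul _ _
          _ ≤ |s| * M := mul_le_mul_of_nonneg_left (hM g) (abs_nonneg s)
    calc (0 : ℝ) < Real.exp (-(|s| * M)) := Real.exp_pos _
      _ = ∫ _g, Real.exp (-(|s| * M)) ∂haarProbability G := by simp
      _ ≤ ∫ g, f₀ g ∂haarProbability G := integral_mono (integrable_const _) hf₀i hlow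
  have hratio := defect_ratio_bound (St × Option (Fin 3)) G (haarProbability G) (1 : G) Sset AK F₀ F₁ F₂
    B (max M₀ M₂) hAKc.measurable hF₀m hF₁m hF₂m hAK hF₁nn hF₁le
    (fun U => (hM₀ U).trans (le_max_left _ _)) (fun U => (hF₂pos U).le)
    (fun U => (hM₂ U).trans (le_max_right _ _)) hdep₀ hdep₁ hdep₂
    (by rw [show (Measure.pi fun _ : St × Option (Fin 3) => haarProbability G) = ν from rfl, hIF₀]
        exact pow_pos hf₀int_pos _)
  rw [show (Measure.pi fun _ : St × Option (Fin 3) => haarProbability G) = ν from rfl, hIF₁, hIF₀]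
    at hratio
  have hexp : Real.exp (2 * B) = (Real.exp (12 * r.N * |β|)) ^ k := by
    rw [← Real.exp_nat_mul, hB]; congr 1; ring
  have hdiv : (∫ g, f₁ g ∂haarProbability G) ^ k / (∫ g, f₀ g ∂haarProbability G) ^ k =
      ((∫ g, f₁ g ∂haarProbability G) / (∫ g, f₀ g ∂haarProbability G)) ^ k := by
    rw [div_pow]
  calc ∫ U, (∏ x ∈ K, D.indicator (fun _ => (1 : ℝ)) (U (top x))) * wgt (kill U) ∂ν
      = ∫ U, Real.exp (AK U) * (F₁ U * F₂ U) ∂ν := by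
        refine integral_congr_ae (ae_of_all _ fun U => ?_); exact hnumk U
    _ ≤ Real.exp (2 * B) * ((∫ g, f₁ g ∂haarProbability G) ^ k / (∫ g, f₀ g ∂haarProbability G) ^ k) *
          ∫ U, Real.exp (AK U) * (F₀ U * F₂ U) ∂ν := hratio
    _ = (Real.exp (12 * r.N * |β|) * ((∫ g in D, Real.exp (-(s * V g)) ∂haarProbability G) /
          (∫ g, Real.exp (-(s * V g)) ∂haarProbability G))) ^ k * ∫ U, wgt (kill U) ∂ν := by
        rw [hexp, hdiv, ← mul_pow, hf₁int]
        congr 1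
        refine integral_congr_ae (ae_of_all _ fun U => ?_); exact (hwk U).symm

end Defects

end Summit.QuantumFields.YangMills.Theorems.AnchorGap

end
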